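import Literature.AlgebraicGeometry.Frobenioids.ArchimedeanIsometrizationFunctors
import HarnessLib

/-!
# Frobenioids II, Theorem 3.6 (iii), the equivalence `C ⥲ A ×_{A^istr} C^istr` — PROVED for
# `C = C₀ ×_{D₀} D`

Mochizuki, *The geometry of Frobenioids II*, Kyushu J. Math. **62** (2008) 401–460, §3, Theorem 3.6
(iii), author's kurims text p. 37, proof p. 39 [cite: MochizukiFrdII2008, Thm 3.6 (iii) p.37]: "The
resulting functor `C → A ×_{A^istr} C^istr` is then manifestly essentially surjective and 1-compatible
with the natural functors to `F_Φ` on both sides. Now the fully faithfulness of this functor is immediate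
from the factorization just discussed, together with the 1-compatibility […]."

DISCHARGE of the instance `ArchFrd.Thm36iii_equivalence_C π` (`ArchimedeanIsometrizationFunctors.lean`)
over ANY base `π : D → D₀`: the functor `T = (isom, istr) : C → A ×_{A^istr} C^istr` is
* faithful — an arrow of `C` is recovered from its isotropification (same data);
* full — given an isometry `α : X → Y` and an arrow `β : X^istr → Y^istr` with `istr(α) =` the
  isometric part of `β`, the arrow `φ := (radial endomorphism of Y with scalar ratio(β)⁻¹) ∘ α` of `C`
  has isometric part `α` (uniqueness of the factorization, `C0.eq_parts_of_factorization`) and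
  isotropification `β`;
* essentially surjective — `(Y, Z, γ : Y^istr ≅ Z)` is the image of `Y` up to the isomorphism
  `(id, γ)` (the isometric part of the isometry `γ` is `γ`);
and `T ⋙ pr₂ ⋙ (C^istr → F_Φ)` IS `C → F_Φ` (0-commutativity, hence 1-commutativity).
Everything is PROVED; no statement of the paper is strengthened; nothing here bears on [IUTchIII].
-/

namespace Literature.AlgebraicGeometry.Frobenioids

open CategoryTheory
open scoped Pointwise

noncomputable section

universe v u

namespace ArchFrd

namespace C0

variable {X Y : C0}

/-- The radial endomorphism `(id, 1, r)` of `Y` for a real `0 < r ≤ 1` (an element of `O^▷(Y)` in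
`Φ^gp(Y) × {1}`; cf. the radial part of Thm. 3.6 (iii)). [cite: MochizukiFrdII2008, Thm 3.6 (iii) p.37] -/
def radialEnd (Y : C0) (r : PosReal) (hr : r ≤ 1) : Y ⟶ Y where
  base := 𝟙 Y.base
  degFr := 1
  scalar := ofPosReal ℂ r
  scalar_mem := ofPosReal_mem_scalars _ _
  mapsTo := by
    rw [PNat.one_coe, pow_one, pullRegion_id]
    rintro _ ⟨u, hu, rfl⟩
    refine ⟨?_, ?_⟩
    · change unitPart ℂ (ofPosReal ℂ r * u) ∈ Y.region.dir
      rw [unitPart_ofPosReal_mul]; exact hu.1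
    · have hu2 : ‖(u : ℂ)‖ ≤ Y.tip := by
        have := hu.2
        rw [← Subtype.coe_le_coe, coe_absHom] at this
        exact this
      have h1 : (r : ℝ) ≤ 1 := Subtype.coe_le_coe.2 hr
      change absHom ℂ (ofPosReal ℂ r * u) ≤ Y.region.tip
      rw [← Subtype.coe_le_coe, coe_absHom, Units.val_mul, norm_mul, norm_coe_ofPosReal]
      calc (r : ℝ) * ‖(u : ℂ)‖ ≤ 1 * ‖(u : ℂ)‖ := by gcongr
        _ = ‖(u : ℂ)‖ := one_mul _
        _ ≤ Y.tip := hu2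

end C0

variable {D : Type u} [Category.{v} D] (π : D ⥤ D0)

/-- The radial endomorphism `((id, 1, r), id)` of an object of `C`, `0 < r ≤ 1`.
[cite: MochizukiFrdII2008, Thm 3.6 (iii) p.37] -/
def radialEndC (Y : C π) (r : PosReal) (hr : r ≤ 1) : Y ⟶ Y where
  fst := C0.radialEnd Y.fst r hr
  snd := 𝟙 Y.snd
  w := by
    change 𝟙 _ ≫ Y.iso.hom = Y.iso.hom ≫ π.map (𝟙 Y.snd)
    rw [CategoryTheory.Functor.map_id, Category.id_comp, Category.comp_id]

/-- The functor `T = (isom, istr) : C → A ×_{A^istr} C^istr` of Thm. 3.6 (iii).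
[cite: MochizukiFrdII2008, Thm 3.6 (iii) p.37] -/
abbrev cfpFunctor : C π ⥤ CFP (A.istrFunctor π) (isomIFunctor π) :=
  toCFP (A.istrFunctor π) (isomIFunctor π) (isomFunctor π) (istrFunctor π) (eIso π)

/-! ### Faithful -/

/-- An arrow of `C` is determined by its isotropification (same data `(Base, deg_Fr, c; D-part)`).
[cite: MochizukiFrdII2008, Thm 3.6 (iii) p.37] -/
theorem istrMap_injective {X Y : C π} {φ ψ : X ⟶ Y} (h : istrMap π φ = istrMap π ψ) : φ = ψ := by
  have hb : C0.Base (istrMap π φ).fst = C0.Base (istrMap π ψ).fst := congrArg (fun k => C0.Base k.fst) h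
  have hd : C0.degFr (istrMap π φ).fst = C0.degFr (istrMap π ψ).fst := congrArg (fun k => C0.degFr k.fst) h
  have hc : C0.scalar (istrMap π φ).fst = C0.scalar (istrMap π ψ).fst :=
    congrArg (fun k => C0.scalar k.fst) h
  have hs : (istrMap π φ).snd = (istrMap π ψ).snd := congrArg CFP.Hom.snd h
  exact CFP.hom_ext (C0.hom_ext hb hd hc) hs

/-- `T` is faithful. [cite: MochizukiFrdII2008, Thm 3.6 (iii) p.37] -/
theorem faithful_cfpFunctor : (cfpFunctor π).Faithful :=
  ⟨fun {_ _} _ _ h => istrMap_injective π (congrArg (fun k => k.snd.hom) h)⟩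

/-! ### Full -/

section Full

variable {X Y : C π} (α : X ⟶ Y) (hα : PreFrobenioid.IsIsometry (C.toElem π) α)
  (β : istrObj π X ⟶ istrObj π Y) (hw : istrMap π α = isometricPart π β)

/-- The ratio `t ≥ 1` of `β`, as `r = t⁻¹ ≤ 1`. [cite: MochizukiFrdII2008, Thm 3.6 (iii) p.37] -/
theorem inv_ratioPos_le_one : (C0.ratioPos β.fst)⁻¹ ≤ 1 :=
  Subtype.coe_le_coe.1 (by rw [Positive.coe_inv]; exact inv_le_one_of_one_le₀ (C0.one_le_ratio _))

/-- The preimage: `φ := α ≫ (radial endomorphism of `Y` with scalar ratio(β)⁻¹)`.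
[cite: MochizukiFrdII2008, Thm 3.6 (iii) p.37] -/
def preimageHom : X ⟶ Y :=
  α ≫ radialEndC π Y (C0.ratioPos β.fst)⁻¹ (inv_ratioPos_le_one π β)

include hα in
/-- The isometric part of the preimage is `α` (uniqueness of the factorization of Thm. 3.6 (iii)).
[cite: MochizukiFrdII2008, Thm 3.6 (iii) p.37] -/
theorem isometricPart_preimageHom : isometricPart π (preimageHom π α β) = α := by
  have hα0 : PreFrobenioid.IsIsometry C0.toElem α.fst := hα
  set r : PosReal := (C0.ratioPos β.fst)⁻¹ with hr
  have him : ((C0.scalar (C0.radialEnd Y.fst r (inv_ratioPos_le_one π β)) : ℂˣ) : ℂ).im = 0 :=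
    Complex.ofReal_im _
  have hre : 0 < ((C0.scalar (C0.radialEnd Y.fst r (inv_ratioPos_le_one π β)) : ℂˣ) : ℂ).re := by
    change 0 < (((r : ℝ) : ℂ)).re
    rw [Complex.ofReal_re]; exact r.2
  have h := (C0.eq_parts_of_factorization (φ := (preimageHom π α β).fst) hα0 rfl rfl him hre rfl).1
  refine CFP.hom_ext h.symm ?_
  change α.snd ≫ 𝟙 _ = α.snd
  rw [Category.comp_id]

include hw in
/-- The isotropification of the preimage is `β`. [cite: MochizukiFrdII2008, Thm 3.6 (iii) p.37] -/
theorem istrMap_preimageHom : istrMap π (preimageHom π α β) = β := by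
  have hb : C0.Base (istrMap π α).fst = C0.Base (isometricPart π β).fst := congrArg (fun g => C0.Base g.fst) hw
  have hd : C0.degFr (istrMap π α).fst = C0.degFr (isometricPart π β).fst :=
    congrArg (fun g => C0.degFr g.fst) hw
  have hc : C0.scalar (istrMap π α).fst = C0.scalar (isometricPart π β).fst :=
    congrArg (fun g => C0.scalar g.fst) hw
  have hsnd : (istrMap π α).snd = (isometricPart π β).snd := congrArg CFP.Hom.snd hw
  refine CFP.hom_ext (C0.hom_ext ?_ ?_ ?_) ?_
  · change C0.Base α.fst ≫ 𝟙 _ = C0.Base β.fst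
    rw [Category.comp_id]; exact hb
  · change C0.degFr α.fst * 1 = C0.degFr β.fst
    rw [mul_one]; exact hd
  · change (C0.Base α.fst).act (ofPosReal ℂ (C0.ratioPos β.fst)⁻¹) * C0.scalar α.fst ^ ((1 : ℕ+) : ℕ) =
      C0.scalar β.fst
    change D0.galAct _ _ * _ = _
    have hc' : C0.scalar α.fst = C0.scalar β.fst * ofPosReal ℂ (C0.ratioPos β.fst) := hc
    rw [D0.galAct_eq_self_of_mem_scalars_real _ (ofPosReal_mem_scalars _ .real), PNat.one_coe, pow_one, hc',
      map_inv, mul_comm, mul_assoc, mul_inv_cancel, mul_one]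
  · change α.snd ≫ 𝟙 _ = β.snd
    rw [Category.comp_id]; exact hsnd

end Full

/-- The compatibility square of a morphism `k` of `A ×_{A^istr} C^istr` between images of `T`, unfolded:
`istr(α) = isometric part of β`. [cite: MochizukiFrdII2008, Thm 3.6 (iii) p.37] -/
theorem hom_w_eq {X Y : C π} (k : (cfpFunctor π).obj X ⟶ (cfpFunctor π).obj Y) :
    istrMap π k.fst.1 = isometricPart π k.snd.hom := by
  have hw := k.w
  change (A.istrFunctor π).map k.fst ≫ 𝟙 _ = 𝟙 _ ≫ (isomIFunctor π).map k.snd at hw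
  rw [Category.comp_id, Category.id_comp] at hw
  exact congrArg (fun f => f.hom.1) hw

/-- `T` is full. [cite: MochizukiFrdII2008, Thm 3.6 (iii) p.37] -/
theorem full_cfpFunctor : (cfpFunctor π).Full :=
  ⟨fun k => ⟨preimageHom π k.fst.1 k.snd.hom,
    CFP.hom_ext (WideSubcategory.hom_ext _ (isometricPart_preimageHom π k.fst.1 k.fst.2 k.snd.hom))
      (ObjectProperty.hom_ext _ (istrMap_preimageHom π k.fst.1 k.snd.hom (hom_w_eq π k)))⟩⟩

/-! ### Essentially surjective -/

/-- The isometric part of an isometry of `C` is the isometry itself. [cite: MochizukiFrdII2008, Thm 3.6 (iii) p.37] -/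
theorem isometricPart_of_isIsometry {X Y : C π} (φ : X ⟶ Y) (h : PreFrobenioid.IsIsometry (C.toElem π) φ) :
    isometricPart π φ = φ :=
  CFP.hom_ext (C0.isometricPart_of_isIsometry φ.fst h) rfl

/-- `T` is essentially surjective: `(Y, Z, γ)` comes from `Y`. [cite: MochizukiFrdII2008, Thm 3.6 (iii) p.37] -/
theorem essSurj_cfpFunctor : (cfpFunctor π).EssSurj where
  mem_essImage W := by
    -- `γ : Y^istr ⟶ Z`, the arrow of `C` underlying `W.iso.hom` (an isometry, invertible)
    let γ : istrObj π W.fst.obj ⟶ W.snd.obj := W.iso.hom.hom.1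
    let γ' : W.snd.obj ⟶ istrObj π W.fst.obj := W.iso.inv.hom.1
    have hγ : PreFrobenioid.IsIsometry (C.toElem π) γ := W.iso.hom.hom.2
    have h1 : γ ≫ γ' = 𝟙 _ := congrArg (fun f => f.hom.1) W.iso.hom_inv_id
    have h2 : γ' ≫ γ = 𝟙 _ := congrArg (fun f => f.hom.1) W.iso.inv_hom_id
    let eC : istrObj π W.fst.obj ≅ W.snd.obj := ⟨γ, γ', h1, h2⟩
    refine ⟨W.fst.obj, ⟨CFP.isoMk (Iso.refl _) (ObjectProperty.isoMk _ eC) ?_⟩⟩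
    apply ObjectProperty.hom_ext
    apply WideSubcategory.hom_ext _
    change istrMap π (𝟙 W.fst.obj) ≫ γ = 𝟙 _ ≫ isometricPart π γ
    rw [Category.id_comp, isometricPart_of_isIsometry π γ hγ,
      show istrMap π (𝟙 W.fst.obj) = 𝟙 _ from (istrEndo π).map_id W.fst.obj, Category.id_comp]

/-- `T` is an equivalence. [cite: MochizukiFrdII2008, Thm 3.6 (iii) p.37] -/
theorem isEquivalence_cfpFunctor : (cfpFunctor π).IsEquivalence where
  faithful := faithful_cfpFunctor π
  full := full_cfpFunctor π
  essSurj := essSurj_cfpFunctor π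

/-- 0-commutativity (hence 1-commutativity) with the functors to `F_Φ`: through `C^istr → F_Φ`, `T` is
compatible ON THE NOSE with `C → F_Φ` (isotropification changes neither `Base`, `Div`, nor `deg_Fr`).
[cite: MochizukiFrdII2008, Thm 3.6 (iii) p.37] -/
theorem cfpFunctor_comp_eq :
    cfpFunctor π ⋙ (CFP.proj₂ (A.istrFunctor π) (isomIFunctor π) ⋙ istr (C.toElem π)) =
      𝟭 (C π) ⋙ C.toElem π := rfl

/-- **Theorem 3.6 (iii), the equivalence `C ⥲ A ×_{A^istr} C^istr`, for `C = C₀ ×_{D₀} D`** (PROVED over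
any base `π : D → D₀`), 1-compatibly with the functors to `F_Φ`. [cite: MochizukiFrdII2008, Thm 3.6 (iii) p.37] -/
theorem thm36iii_equivalence_C : Thm36iii_equivalence_C π :=
  ⟨isEquivalence_cfpFunctor π, ⟨eqToIso (cfpFunctor_comp_eq π)⟩⟩

end ArchFrd

end

end Literature.AlgebraicGeometry.Frobenioids
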